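import Mathlib
import HarnessLib
import Summits.QuantumFields.YangMills.Theses.GronwallGap
import Summits.QuantumFields.YangMills.Theorems.GronwallGapPathGapModulusNearHaarFloor
import Summits.QuantumFields.YangMills.Theorems.GronwallGapPathGapModulusStubClosedOfUniformConstants
import Literature.MathematicalPhysics.QuantumFieldTheory.PlaquetteWeightTorusSystem
import Literature.Analysis.Convex.PointwiseLimitDeriv
import Literature.Analysis.Convex.PointwiseLimitDerivAt

/-!
# `PathGapModulus` (stmt-QuantumFields-13946), line `registered`, stub `stub_onePointContinuous`

Helper for the crux `Summit.QuantumFields.YangMills.Theses.GronwallGap.PathGapModulus` (route `GronwallGap`).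
Stub E: along an admissible weight path with Gateaux-analytic torus pressure at every parameter, the infinite-volume
limits of the plaquette-averaged one-point functions of every continuous class function exist and are continuous in `s`
(finite-volume pressure = constant + cumulant generating function; Griffiths' lemma; Lipschitz dependence of `Pseq` on `log v`).

* `convexOn_differentiable_cgf` — the cumulant generating function of a random variable with all exponential
  moments is convex and differentiable on `ℝ` with derivative the mean at `0` (Mathlib's `cgf` API);
* finite-volume plaquette-weight torus lemmas: `Z(v) = ∫ ∏_q v(U_q) dπ > 0`, the state is a probability measure,
  `log Z(v e^(tφ)) = log Z(v) + cgf_(Σ_q φ(U_q)) t` (`log_withDensity_tilt_eq_add_cgf`), the tilted pressure is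
  convex with derivative the summed one-point function (`torusPressure_tilt`), and
  `|log Z(v) − log Z(v')| ≤ #plaquettes · sup |log v − log v'|` (`abs_log_withDensity_sub_le`);
* `stub_onePointContinuous` — the registered stub.
-/

namespace Summit.QuantumFields.YangMills.Theorems

open MeasureTheory Filter Topology ProbabilityTheory
open Literature.MathematicalPhysics.QuantumFieldTheory
open Literature.MathematicalPhysics.QuantumLattice (groupHeatKernelWeight groupHeatKernelMeasure
  continuous_plaquetteHolonomy)

section Convex

/-- The cumulant generating function `t ↦ log ∫ e^(tX) dμ` of a random variable `X` with all exponential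
moments finite (probability measure `μ`) is convex and differentiable on `ℝ`, with derivative `μ[X]` at `0`
(Mathlib: `analyticAt_cgf`, `iteratedDeriv_two_cgf_eq_integral ≥ 0`, `deriv_cgf_zero`). [folklore] -/
theorem convexOn_differentiable_cgf {Ω : Type*} [MeasurableSpace Ω] {μ : Measure Ω}
    [IsProbabilityMeasure μ] {X : Ω → ℝ} (hX : ∀ t : ℝ, Integrable (fun ω => Real.exp (t * X ω)) μ) :
    ConvexOn ℝ Set.univ (cgf X μ) ∧ Differentiable ℝ (cgf X μ) ∧ deriv (cgf X μ) 0 = μ[X] := by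
  have hI : integrableExpSet X μ = Set.univ := Set.eq_univ_of_forall fun t => hX t
  have hmem : ∀ t, t ∈ interior (integrableExpSet X μ) := fun t => by
    rw [hI, interior_univ]
    exact Set.mem_univ t
  have han : ∀ t, AnalyticAt ℝ (cgf X μ) t := fun t => analyticAt_cgf (hmem t)
  have hd : Differentiable ℝ (cgf X μ) := fun t => (han t).differentiableAt
  have hd2 : Differentiable ℝ (deriv (cgf X μ)) := fun t => (han t).deriv.differentiableAt
  refine ⟨convexOn_univ_of_deriv2_nonneg hd hd2 fun t => ?_, hd, ?_⟩
  · rw [← iteratedDeriv_eq_iterate, iteratedDeriv_two_cgf_eq_integral (hmem t)]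
    exact div_nonneg (integral_nonneg fun ω => by positivity) mgf_nonneg
  · rw [deriv_cgf_zero (hmem 0)]
    simp

end Convex

section Weight

variable {G : Type*} [Group G] {d L : ℕ} [NeZero L]

/-- Tilting the single-plaquette weight by `e^(tφ)` multiplies the torus weight `∏_q v(U_q)` by
`exp (t Σ_q φ(U_q))`. [folklore] -/
theorem groupHeatKernelWeight_mul_exp (v φ : G → ℝ) (t : ℝ) (U : GaugeConfig d L G) :
    groupHeatKernelWeight (d := d) (L := L) (fun _ : ℝ => fun g => v g * Real.exp (t * φ g)) 0 U =
      groupHeatKernelWeight (d := d) (L := L) (fun _ : ℝ => v) 0 U *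
        Real.exp (t * ∑ q : Plaquette d L, φ (plaquetteHolonomy U q.1 q.2.1.1 q.2.1.2)) := by
  unfold Literature.MathematicalPhysics.QuantumLattice.groupHeatKernelWeight
  rw [Finset.prod_mul_distrib, Finset.mul_sum, Real.exp_sum]

/-- If `log v ≤ log v' + δ` pointwise (`v, v' > 0`), the torus weights satisfy
`∏_q v(U_q) ≤ (∏_q v'(U_q)) · exp (#plaquettes · δ)`. [folklore] -/
theorem groupHeatKernelWeight_le_mul_exp {v v' : G → ℝ} (hv0 : ∀ g, 0 < v g) (hv'0 : ∀ g, 0 < v' g)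
    {δ : ℝ} (hδ : ∀ g, Real.log (v g) ≤ Real.log (v' g) + δ) (U : GaugeConfig d L G) :
    groupHeatKernelWeight (d := d) (L := L) (fun _ : ℝ => v) 0 U ≤
      groupHeatKernelWeight (d := d) (L := L) (fun _ : ℝ => v') 0 U *
        Real.exp (Fintype.card (Plaquette d L) * δ) := by
  have hvv' : ∀ g, v g ≤ v' g * Real.exp δ := fun g =>
    calc v g = Real.exp (Real.log (v g)) := (Real.exp_log (hv0 g)).symm
      _ ≤ Real.exp (Real.log (v' g) + δ) := Real.exp_le_exp.2 (hδ g)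
      _ = v' g * Real.exp δ := by rw [Real.exp_add, Real.exp_log (hv'0 g)]
  unfold Literature.MathematicalPhysics.QuantumLattice.groupHeatKernelWeight
  calc ∏ q : Plaquette d L, v (plaquetteHolonomy U q.1 q.2.1.1 q.2.1.2)
      ≤ ∏ q : Plaquette d L, (v' (plaquetteHolonomy U q.1 q.2.1.1 q.2.1.2) * Real.exp δ) :=
        Finset.prod_le_prod (fun _ _ => (hv0 _).le) fun _ _ => hvv' _
    _ = (∏ q : Plaquette d L, v' (plaquetteHolonomy U q.1 q.2.1.1 q.2.1.2)) *
          Real.exp (Fintype.card (Plaquette d L) * δ) := by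
        rw [Finset.prod_mul_distrib, Finset.prod_const, Finset.card_univ, Real.exp_nat_mul]

/-- `#plaquettes` of the four-dimensional torus of side `N` is `6 N⁴`. [folklore] -/
theorem card_plaquette_four (N : ℕ) [NeZero N] :
    (Fintype.card (Plaquette 4 N) : ℝ) = 6 * (N : ℝ) ^ 4 := by
  have h6 : Fintype.card {p : Fin 4 × Fin 4 // p.1 < p.2} = 6 := by decide
  rw [Fintype.card_prod, Fintype.card_fun, ZMod.card, Fintype.card_fin, h6]
  push_cast
  ring

end Weight

section FiniteVolume

variable {G : Type*} [Group G] [TopologicalSpace G] [IsTopologicalGroup G] [CompactSpace G]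
  [MeasurableSpace G] [BorelSpace G] [SecondCountableTopology G] {d L : ℕ} [NeZero L]

omit [Group G] [IsTopologicalGroup G] in
/-- A continuous real function on the (compact) torus configuration space is integrable against every
finite measure. [folklore] -/
theorem integrable_of_continuous_gaugeConfig {F : GaugeConfig d L G → ℝ} (hF : Continuous F)
    (ν : Measure (GaugeConfig d L G)) [IsFiniteMeasure ν] : Integrable F ν := by
  obtain ⟨C, hC⟩ := isCompact_univ.exists_bound_of_continuousOn hF.continuousOn
  exact Integrable.of_bound hF.measurable.aestronglyMeasurable C
    (Eventually.of_forall fun U => hC U (Set.mem_univ U))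

/-- The partition function of a continuous positive plaquette weight is positive:
`0 < ∫ ∏_q v(U_q) dπ`. [folklore] -/
theorem integral_groupHeatKernelWeight_pos {v : G → ℝ} (hv : Continuous v) (hv0 : ∀ g, 0 < v g) :
    0 < ∫ U, groupHeatKernelWeight (d := d) (L := L) (fun _ : ℝ => v) 0 U
      ∂(Measure.pi fun _ : Edge d L => haarProbability G) := by
  refine (integral_pos_iff_support_of_nonneg
    (fun U => (groupHeatKernelWeight_pos' (w := fun _ : ℝ => v) (s := 0) hv0 U).le)
    (integrable_of_continuous_gaugeConfig
      (continuous_groupHeatKernelWeight (w := fun _ : ℝ => v) (s := 0) hv) _)).2 ?_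
  have hsupp : Function.support (fun U : GaugeConfig d L G =>
      groupHeatKernelWeight (d := d) (L := L) (fun _ : ℝ => v) 0 U) = Set.univ := by
    ext U
    simp [(groupHeatKernelWeight_pos' (w := fun _ : ℝ => v) (s := 0) hv0 U).ne']
  rw [hsupp, measure_univ]
  exact one_pos

/-- The total mass of the weighted product Haar measure is `ENNReal.ofReal` of the partition function
`∫ ∏_q v(U_q) dπ`. [folklore] -/
theorem withDensity_groupHeatKernelWeight_univ {v : G → ℝ} (hv : Continuous v) (hv0 : ∀ g, 0 < v g) :
    ((Measure.pi fun _ : Edge d L => haarProbability G).withDensity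
        (fun U : GaugeConfig d L G =>
          ENNReal.ofReal (groupHeatKernelWeight (d := d) (L := L) (fun _ : ℝ => v) 0 U))) Set.univ =
      ENNReal.ofReal (∫ U, groupHeatKernelWeight (d := d) (L := L) (fun _ : ℝ => v) 0 U
        ∂(Measure.pi fun _ : Edge d L => haarProbability G)) := by
  rw [withDensity_apply _ MeasurableSet.univ, Measure.restrict_univ,
    ofReal_integral_eq_lintegral_ofReal
      (integrable_of_continuous_gaugeConfig
        (continuous_groupHeatKernelWeight (w := fun _ : ℝ => v) (s := 0) hv) _)
      (Eventually.of_forall fun U =>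
        (groupHeatKernelWeight_pos' (w := fun _ : ℝ => v) (s := 0) hv0 U).le)]

/-- The plaquette-weight torus state of a continuous positive weight is a probability measure. [folklore] -/
theorem isProbabilityMeasure_groupHeatKernelMeasure_of_pos {v : G → ℝ} (hv : Continuous v)
    (hv0 : ∀ g, 0 < v g) :
    IsProbabilityMeasure (groupHeatKernelMeasure (d := d) (L := L) (fun _ : ℝ => v) 0) := by
  rw [Literature.MathematicalPhysics.QuantumLattice.groupHeatKernelMeasure_eq]
  refine ⟨?_⟩
  rw [Measure.smul_apply, smul_eq_mul, withDensity_groupHeatKernelWeight_univ hv hv0]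
  exact ENNReal.inv_mul_cancel
    (ENNReal.ofReal_pos.2 (integral_groupHeatKernelWeight_pos hv hv0)).ne' ENNReal.ofReal_ne_top

/-- **Finite-volume pressure = constant + cumulant generating function.** For a continuous positive
plaquette weight `v` and a continuous `φ`,
`log Z(v e^(tφ)) = log Z(v) + cgf_(Σ_q φ(U_q)) (μ_v) t`, the cumulant generating function of the summed
observable under the `v`-torus state. [folklore] -/
theorem log_withDensity_tilt_eq_add_cgf {v φ : G → ℝ} (hv : Continuous v) (hv0 : ∀ g, 0 < v g)
    (hφ : Continuous φ) (t : ℝ) :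
    Real.log (((Measure.pi fun _ : Edge d L => haarProbability G).withDensity
        (fun U : GaugeConfig d L G => ENNReal.ofReal (groupHeatKernelWeight (d := d) (L := L)
          (fun _ : ℝ => fun g => v g * Real.exp (t * φ g)) 0 U))) Set.univ).toReal =
      Real.log (((Measure.pi fun _ : Edge d L => haarProbability G).withDensity
        (fun U : GaugeConfig d L G => ENNReal.ofReal (groupHeatKernelWeight (d := d) (L := L)
          (fun _ : ℝ => v) 0 U))) Set.univ).toReal +
      cgf (fun U : GaugeConfig d L G => ∑ q : Plaquette d L, φ (plaquetteHolonomy U q.1 q.2.1.1 q.2.1.2))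
        (groupHeatKernelMeasure (d := d) (L := L) (fun _ : ℝ => v) 0) t := by
  have hvt : Continuous fun g => v g * Real.exp (t * φ g) :=
    hv.mul (Real.continuous_exp.comp (continuous_const.mul hφ))
  have hvt0 : ∀ g, 0 < v g * Real.exp (t * φ g) := fun g => mul_pos (hv0 g) (Real.exp_pos _)
  haveI := isProbabilityMeasure_groupHeatKernelMeasure_of_pos (d := d) (L := L) hv hv0
  have hΦc : Continuous fun U : GaugeConfig d L G =>
      ∑ q : Plaquette d L, φ (plaquetteHolonomy U q.1 q.2.1.1 q.2.1.2) :=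
    continuous_finsetSum _ fun q _ => hφ.comp (continuous_plaquetteHolonomy _ _ _)
  have hint : Integrable (fun U : GaugeConfig d L G =>
      Real.exp (t * ∑ q : Plaquette d L, φ (plaquetteHolonomy U q.1 q.2.1.1 q.2.1.2)))
      (groupHeatKernelMeasure (d := d) (L := L) (fun _ : ℝ => v) 0) :=
    integrable_of_continuous_gaugeConfig (Real.continuous_exp.comp (continuous_const.mul hΦc)) _
  rw [withDensity_groupHeatKernelWeight_univ hvt hvt0, withDensity_groupHeatKernelWeight_univ hv hv0,
    ENNReal.toReal_ofReal (integral_groupHeatKernelWeight_pos hvt hvt0).le,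
    ENNReal.toReal_ofReal (integral_groupHeatKernelWeight_pos hv hv0).le]
  have hI : ∫ U, groupHeatKernelWeight (d := d) (L := L)
        (fun _ : ℝ => fun g => v g * Real.exp (t * φ g)) 0 U
        ∂(Measure.pi fun _ : Edge d L => haarProbability G) =
      (∫ U, groupHeatKernelWeight (d := d) (L := L) (fun _ : ℝ => v) 0 U
        ∂(Measure.pi fun _ : Edge d L => haarProbability G)) *
      mgf (fun U : GaugeConfig d L G => ∑ q : Plaquette d L, φ (plaquetteHolonomy U q.1 q.2.1.1 q.2.1.2))
        (groupHeatKernelMeasure (d := d) (L := L) (fun _ : ℝ => v) 0) t := by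
    rw [mgf, Literature.MathematicalPhysics.QuantumLattice.groupHeatKernelMeasure_eq,
      integral_normalised_withDensity _
        (continuous_groupHeatKernelWeight (w := fun _ : ℝ => v) (s := 0) hv).measurable
        (groupHeatKernelWeight_pos' (w := fun _ : ℝ => v) (s := 0) hv0)
        (integrable_of_continuous_gaugeConfig
          (continuous_groupHeatKernelWeight (w := fun _ : ℝ => v) (s := 0) hv) _),
      mul_div_cancel₀ _ (integral_groupHeatKernelWeight_pos hv hv0).ne']
    exact integral_congr_ae (Eventually.of_forall fun U => groupHeatKernelWeight_mul_exp v φ t U)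
  rw [hI, Real.log_mul (integral_groupHeatKernelWeight_pos hv hv0).ne' (mgf_pos hint).ne', cgf]

/-- **Convexity of the tilted finite-volume pressure.** For a continuous positive plaquette weight `v`,
a continuous `φ` and `c ≥ 0`, the function `F t = c · log Z(v e^(tφ))` is convex and differentiable on `ℝ`,
with `F'(0) = c · Σ_q ⟨φ(U_q)⟩_v`. [folklore] -/
theorem torusPressure_tilt {v φ : G → ℝ} (hv : Continuous v) (hv0 : ∀ g, 0 < v g)
    (hφ : Continuous φ) {c : ℝ} (hc : 0 ≤ c) {F : ℝ → ℝ}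
    (hF : ∀ t, F t = c * Real.log (((Measure.pi fun _ : Edge d L => haarProbability G).withDensity
        (fun U : GaugeConfig d L G => ENNReal.ofReal (groupHeatKernelWeight (d := d) (L := L)
          (fun _ : ℝ => fun g => v g * Real.exp (t * φ g)) 0 U))) Set.univ).toReal) :
    ConvexOn ℝ Set.univ F ∧ Differentiable ℝ F ∧
      deriv F 0 = c * ∑ q : Plaquette d L, ∫ U, φ (plaquetteHolonomy U q.1 q.2.1.1 q.2.1.2)
        ∂(groupHeatKernelMeasure (d := d) (L := L) (fun _ : ℝ => v) 0) := by
  haveI := isProbabilityMeasure_groupHeatKernelMeasure_of_pos (d := d) (L := L) hv hv0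
  set μ : Measure (GaugeConfig d L G) := groupHeatKernelMeasure (d := d) (L := L) (fun _ : ℝ => v) 0
    with hμ
  set Φ : GaugeConfig d L G → ℝ := fun U =>
    ∑ q : Plaquette d L, φ (plaquetteHolonomy U q.1 q.2.1.1 q.2.1.2) with hΦ
  set K : ℝ := Real.log (((Measure.pi fun _ : Edge d L => haarProbability G).withDensity
    (fun U : GaugeConfig d L G => ENNReal.ofReal (groupHeatKernelWeight (d := d) (L := L)
      (fun _ : ℝ => v) 0 U))) Set.univ).toReal with hK
  have hΦc : Continuous Φ :=
    continuous_finsetSum _ fun q _ => hφ.comp (continuous_plaquetteHolonomy _ _ _)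
  have hX : ∀ t : ℝ, Integrable (fun U => Real.exp (t * Φ U)) μ := fun t =>
    integrable_of_continuous_gaugeConfig (Real.continuous_exp.comp (continuous_const.mul hΦc)) μ
  obtain ⟨hconv, hdiff, hder⟩ := convexOn_differentiable_cgf hX
  have hFeq : F = fun t => c * (K + cgf Φ μ t) := by
    funext t
    rw [hF t, log_withDensity_tilt_eq_add_cgf hv hv0 hφ t]
  rw [hFeq]
  refine ⟨?_, ?_, ?_⟩
  · exact ConvexOn.smul hc ((convexOn_const K convex_univ).add hconv)
  · exact ((differentiable_const K).add hdiff).const_mul c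
  · have hd' : DifferentiableAt ℝ (fun t => K + cgf Φ μ t) 0 := (hdiff 0).const_add K
    have hint : ∀ q : Plaquette d L, Integrable
        (fun U : GaugeConfig d L G => φ (plaquetteHolonomy U q.1 q.2.1.1 q.2.1.2)) μ := fun q =>
      integrable_of_continuous_gaugeConfig (hφ.comp (continuous_plaquetteHolonomy _ _ _)) μ
    rw [deriv_const_mul c hd', deriv_const_add, hder, ← integral_finsetSum _ fun q _ => hint q]

/-- **Lipschitz dependence of the log-partition function on `log v`** (one-sided form): if
`log v ≤ log v' + δ` pointwise then `log Z(v) ≤ log Z(v') + #plaquettes · δ`. [folklore] -/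
theorem log_withDensity_le_of_log_le {v v' : G → ℝ} (hv : Continuous v) (hv0 : ∀ g, 0 < v g)
    (hv' : Continuous v') (hv'0 : ∀ g, 0 < v' g) {δ : ℝ}
    (hδ : ∀ g, Real.log (v g) ≤ Real.log (v' g) + δ) :
    Real.log (((Measure.pi fun _ : Edge d L => haarProbability G).withDensity
        (fun U : GaugeConfig d L G => ENNReal.ofReal (groupHeatKernelWeight (d := d) (L := L)
          (fun _ : ℝ => v) 0 U))) Set.univ).toReal ≤
      Real.log (((Measure.pi fun _ : Edge d L => haarProbability G).withDensity
        (fun U : GaugeConfig d L G => ENNReal.ofReal (groupHeatKernelWeight (d := d) (L := L)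
          (fun _ : ℝ => v') 0 U))) Set.univ).toReal + Fintype.card (Plaquette d L) * δ := by
  rw [withDensity_groupHeatKernelWeight_univ hv hv0, withDensity_groupHeatKernelWeight_univ hv' hv'0,
    ENNReal.toReal_ofReal (integral_groupHeatKernelWeight_pos hv hv0).le,
    ENNReal.toReal_ofReal (integral_groupHeatKernelWeight_pos hv' hv'0).le]
  have hle : ∫ U, groupHeatKernelWeight (d := d) (L := L) (fun _ : ℝ => v) 0 U
        ∂(Measure.pi fun _ : Edge d L => haarProbability G) ≤
      (∫ U, groupHeatKernelWeight (d := d) (L := L) (fun _ : ℝ => v') 0 U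
        ∂(Measure.pi fun _ : Edge d L => haarProbability G)) *
        Real.exp (Fintype.card (Plaquette d L) * δ) := by
    rw [← integral_mul_const]
    exact integral_mono
      (integrable_of_continuous_gaugeConfig
        (continuous_groupHeatKernelWeight (w := fun _ : ℝ => v) (s := 0) hv) _)
      ((integrable_of_continuous_gaugeConfig
        (continuous_groupHeatKernelWeight (w := fun _ : ℝ => v') (s := 0) hv') _).mul_const _)
      fun U => groupHeatKernelWeight_le_mul_exp hv0 hv'0 hδ U
  have h := Real.log_le_log (integral_groupHeatKernelWeight_pos hv hv0) hle
  rwa [Real.log_mul (integral_groupHeatKernelWeight_pos hv' hv'0).ne' (Real.exp_pos _).ne',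
    Real.log_exp] at h

/-- **Lipschitz dependence of the log-partition function on `log v`:**
`|log Z(v) − log Z(v')| ≤ #plaquettes · δ` whenever `|log v − log v'| ≤ δ` pointwise. [folklore] -/
theorem abs_log_withDensity_sub_le {v v' : G → ℝ} (hv : Continuous v) (hv0 : ∀ g, 0 < v g)
    (hv' : Continuous v') (hv'0 : ∀ g, 0 < v' g) {δ : ℝ}
    (hδ : ∀ g, |Real.log (v g) - Real.log (v' g)| ≤ δ) :
    |Real.log (((Measure.pi fun _ : Edge d L => haarProbability G).withDensity
        (fun U : GaugeConfig d L G => ENNReal.ofReal (groupHeatKernelWeight (d := d) (L := L)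
          (fun _ : ℝ => v) 0 U))) Set.univ).toReal -
      Real.log (((Measure.pi fun _ : Edge d L => haarProbability G).withDensity
        (fun U : GaugeConfig d L G => ENNReal.ofReal (groupHeatKernelWeight (d := d) (L := L)
          (fun _ : ℝ => v') 0 U))) Set.univ).toReal| ≤ Fintype.card (Plaquette d L) * δ := by
  rw [abs_sub_le_iff]
  constructor
  · have h := log_withDensity_le_of_log_le (d := d) (L := L) hv hv0 hv' hv'0 (δ := δ)
      fun g => by linarith [(abs_sub_le_iff.1 (hδ g)).1]
    linarith
  · have h := log_withDensity_le_of_log_le (d := d) (L := L) hv' hv'0 hv hv0 (δ := δ)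
      fun g => by linarith [(abs_sub_le_iff.1 (hδ g)).2]
    linarith

end FiniteVolume

/-- **Stub E — the certificate in correlation language: continuity of the one-point functions (PROVABLE).** For
every compact simple `G` and every admissible weight path `w` with Gateaux-analytic torus pressure at every parameter,
and every continuous class function `φ`: the infinite-volume limits `a s` of the plaquette-averaged torus one-point
functions `(#plaquettes)⁻¹ Σ_q ⟨φ(U_q)⟩_(w_s, L+1)` exist for every `s ∈ [0,1]` and `a` is continuous on `[0,1]`.
Mechanism: `Pseq (w_s e^(tφ)) L = Pseq (w_s) L + (L+1)⁻⁴ · cgf_(Σ_q φ(U_q)) t` (cumulant generating function under the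
`w_s`-torus state: convex, analytic, derivative at `0` = `6 ×` the averaged one-point function); Griffiths' lemma
(`Literature.Analysis.Convex.tendsto_deriv_of_convexOn_of_tendsto`, p155331) gives existence of the limit `= p_s'(0)/6`;
`|Pseq v L − Pseq v' L| ≤ 6 · sup |log v − log v'|` gives `p_(s_k) → p_s` pointwise as `s_k → s`, and Griffiths' lemma
again (variant needing differentiability at `0` only) gives `p_(s_k)'(0) → p_s'(0)`. Size: M/L.
[cite: Ruelle1969, §5.4 (Griffiths' lemma)] -/
theorem stub_onePointContinuous :
    ∀ (G : Type) [Group G] [TopologicalSpace G] [IsTopologicalGroup G] [CompactSpace G],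
      Literature.MathematicalPhysics.QuantumFieldTheory.IsCompactSimpleLieGroup G →
      letI : MeasurableSpace G := borel G; haveI : BorelSpace G := ⟨rfl⟩;
      let Pseq : (G → ℝ) → ℕ → ℝ := fun v L => (((L + 1 : ℕ) : ℝ) ^ 4)⁻¹ * Real.log (((MeasureTheory.Measure.pi fun _ : Literature.MathematicalPhysics.QuantumFieldTheory.Edge 4 (L + 1) => Literature.MathematicalPhysics.QuantumFieldTheory.haarProbability G).withDensity (fun U : Literature.MathematicalPhysics.QuantumFieldTheory.GaugeConfig 4 (L + 1) G => ENNReal.ofReal (Literature.MathematicalPhysics.QuantumLattice.groupHeatKernelWeight (fun _ : ℝ => v) 0 U))) Set.univ).toReal;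
      let AnP : (G → ℝ) → Prop := fun v => ∀ φ : G → ℝ, Continuous φ → (∀ g h : G, φ (h * g * h⁻¹) = φ g) → ∃ p : ℝ → ℝ, (∀ t : ℝ, Filter.Tendsto (fun L : ℕ => Pseq (fun g => v g * Real.exp (t * φ g)) L) Filter.atTop (nhds (p t))) ∧ AnalyticAt ℝ p 0;
      let Adm : (ℝ → G → ℝ) → Prop := fun w => (∀ s ∈ Set.Icc (0 : ℝ) 1, Continuous (w s) ∧ (∀ g : G, 0 < w s g) ∧ (∀ g h : G, w s (h * g * h⁻¹) = w s g) ∧ (∀ g : G, w s g⁻¹ = w s g) ∧ (∀ (n : ℕ) (x : Fin n → G) (c : Fin n → ℂ), 0 ≤ (∑ i, ∑ j, (starRingEnd ℂ) (c i) * c j * ((w s ((x i)⁻¹ * x j) : ℝ) : ℂ)).re)) ∧ ∃ Λ : ℝ, ∀ s ∈ Set.Icc (0 : ℝ) 1, ∀ s' ∈ Set.Icc (0 : ℝ) 1, ∀ g : G, |Real.log (w s g) - Real.log (w s' g)| ≤ Λ * |s - s'|;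
      ∀ w : ℝ → G → ℝ, Adm w → (∀ s ∈ Set.Icc (0 : ℝ) 1, AnP (w s)) →
        ∀ φ : G → ℝ, Continuous φ → (∀ g h : G, φ (h * g * h⁻¹) = φ g) →
          ∃ a : ℝ → ℝ, ContinuousOn a (Set.Icc (0 : ℝ) 1) ∧ ∀ s ∈ Set.Icc (0 : ℝ) 1,
            Filter.Tendsto (fun L : ℕ => ((Fintype.card (Literature.MathematicalPhysics.QuantumFieldTheory.Plaquette 4 (L + 1)) : ℝ))⁻¹ * ∑ q : Literature.MathematicalPhysics.QuantumFieldTheory.Plaquette 4 (L + 1), ∫ U, φ (Literature.MathematicalPhysics.QuantumFieldTheory.plaquetteHolonomy U q.1 q.2.1.1 q.2.1.2) ∂(Literature.MathematicalPhysics.QuantumLattice.groupHeatKernelMeasure (d := 4) (L := L + 1) w s)) Filter.atTop (nhds (a s)) := by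
  intro G _ _ _ _ hG
  letI : MeasurableSpace G := borel G
  haveI : BorelSpace G := ⟨rfl⟩
  intro Pseq AnP Adm w hAdm hAn φ hφ hcl
  obtain ⟨-, ⟨r⟩⟩ := hG
  haveI : SecondCountableTopology G := secondCountable_of_latticeRep r
  obtain ⟨hreg, Λ, hΛ⟩ := hAdm
  -- the explicit form of `Pseq`
  have hP : ∀ (v : G → ℝ) (L : ℕ), Pseq v L = (((L + 1 : ℕ) : ℝ) ^ 4)⁻¹ *
      Real.log (((Measure.pi fun _ : Edge 4 (L + 1) => haarProbability G).withDensity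
        (fun U : GaugeConfig 4 (L + 1) G => ENNReal.ofReal (groupHeatKernelWeight (d := 4) (L := L + 1)
          (fun _ : ℝ => v) 0 U))) Set.univ).toReal := fun v L => rfl
  -- the infinite-volume pressures `p s` of the tilted weights `w s · e^(tφ)`
  have hAn' : ∀ s ∈ Set.Icc (0 : ℝ) 1, ∃ p : ℝ → ℝ,
      (∀ t : ℝ, Tendsto (fun L : ℕ => Pseq (fun g => w s g * Real.exp (t * φ g)) L) atTop (𝓝 (p t))) ∧
        AnalyticAt ℝ p 0 := fun s hs => hAn s hs φ hφ hcl
  choose! p hp using hAn'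
  -- finite volume: the tilted pressures are convex and differentiable, derivative at `0` = summed one-point
  -- function over `(L+1)⁴`
  have hfin : ∀ s ∈ Set.Icc (0 : ℝ) 1, ∀ L : ℕ,
      ConvexOn ℝ Set.univ (fun t => Pseq (fun g => w s g * Real.exp (t * φ g)) L) ∧
      Differentiable ℝ (fun t => Pseq (fun g => w s g * Real.exp (t * φ g)) L) ∧
      deriv (fun t => Pseq (fun g => w s g * Real.exp (t * φ g)) L) 0 =
        (((L + 1 : ℕ) : ℝ) ^ 4)⁻¹ * ∑ q : Plaquette 4 (L + 1),
          ∫ U, φ (plaquetteHolonomy U q.1 q.2.1.1 q.2.1.2)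
            ∂(groupHeatKernelMeasure (d := 4) (L := L + 1) w s) := by
    intro s hs L
    obtain ⟨hc, h0, -⟩ := hreg s hs
    exact torusPressure_tilt (d := 4) (L := L + 1) hc h0 hφ (c := (((L + 1 : ℕ) : ℝ) ^ 4)⁻¹)
      (by positivity) (F := fun t => Pseq (fun g => w s g * Real.exp (t * φ g)) L) (fun t => hP _ L)
  -- finite volume: Lipschitz dependence on the parameter, uniformly in `L` and `t`
  have hLip : ∀ s ∈ Set.Icc (0 : ℝ) 1, ∀ s' ∈ Set.Icc (0 : ℝ) 1, ∀ (L : ℕ) (t : ℝ),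
      |Pseq (fun g => w s g * Real.exp (t * φ g)) L - Pseq (fun g => w s' g * Real.exp (t * φ g)) L| ≤
        6 * Λ * |s - s'| := by
    intro s hs s' hs' L t
    obtain ⟨hc, h0, -⟩ := hreg s hs
    obtain ⟨hc', h0', -⟩ := hreg s' hs'
    have key := abs_log_withDensity_sub_le (d := 4) (L := L + 1)
      (v := fun g => w s g * Real.exp (t * φ g)) (v' := fun g => w s' g * Real.exp (t * φ g))
      (hc.mul (Real.continuous_exp.comp (continuous_const.mul hφ)))
      (fun g => mul_pos (h0 g) (Real.exp_pos _))
      (hc'.mul (Real.continuous_exp.comp (continuous_const.mul hφ)))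
      (fun g => mul_pos (h0' g) (Real.exp_pos _)) (δ := Λ * |s - s'|) fun g => by
        rw [Real.log_mul (h0 g).ne' (Real.exp_pos _).ne', Real.log_exp,
          Real.log_mul (h0' g).ne' (Real.exp_pos _).ne', Real.log_exp, add_sub_add_right_eq_sub]
        exact hΛ s hs s' hs' g
    have hcpos : (0 : ℝ) < (((L + 1 : ℕ) : ℝ) ^ 4)⁻¹ := by positivity
    have hN : ((L + 1 : ℕ) : ℝ) ≠ 0 := by positivity
    rw [card_plaquette_four] at key
    rw [hP, hP, ← mul_sub, abs_mul, abs_of_pos hcpos]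
    refine (mul_le_mul_of_nonneg_left key hcpos.le).trans_eq ?_
    field_simp
  -- the infinite-volume pressures are Lipschitz in the parameter, pointwise in `t`
  have hpLip : ∀ s ∈ Set.Icc (0 : ℝ) 1, ∀ s' ∈ Set.Icc (0 : ℝ) 1, ∀ t : ℝ,
      |p s t - p s' t| ≤ 6 * Λ * |s - s'| := fun s hs s' hs' t =>
    le_of_tendsto (((hp s hs).1 t).sub ((hp s' hs').1 t)).abs
      (Eventually.of_forall fun L => hLip s hs s' hs' L t)
  -- the infinite-volume pressures are convex
  have hpconv : ∀ s ∈ Set.Icc (0 : ℝ) 1, ConvexOn ℝ Set.univ (p s) := fun s hs =>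
    Literature.Analysis.Convex.convexOn_univ_of_tendsto (fun L => (hfin s hs L).1) (hp s hs).1
  -- Griffiths' lemma at fixed `s`: the finite-volume derivatives converge
  have hder : ∀ s ∈ Set.Icc (0 : ℝ) 1,
      Tendsto (fun L : ℕ => deriv (fun t => Pseq (fun g => w s g * Real.exp (t * φ g)) L) 0) atTop
        (𝓝 (deriv (p s) 0)) := fun s hs =>
    Literature.Analysis.Convex.tendsto_deriv_of_convexOn_of_tendsto (fun L => (hfin s hs L).1)
      (fun L => (hfin s hs L).2.1) (hp s hs).1 (hp s hs).2.differentiableAt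
  refine ⟨fun s => deriv (p s) 0 / 6, ?_, fun s hs => ?_⟩
  · -- continuity on `[0,1]`, sequentially, by the Griffiths variant across parameters
    rw [continuousOn_iff_continuous_restrict, continuous_iff_seqContinuous]
    intro x s₀ hx
    have hx' : Tendsto (fun k => (x k : ℝ)) atTop (𝓝 (s₀ : ℝ)) :=
      (continuous_subtype_val.tendsto s₀).comp hx
    show Tendsto (fun k => deriv (p (x k)) 0 / 6) atTop (𝓝 (deriv (p s₀) 0 / 6))
    refine Tendsto.div_const ?_ 6
    refine Literature.Analysis.Convex.tendsto_deriv_of_convexOn_of_tendsto_of_differentiableAt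
      (fun k => hpconv _ (x k).2)
      (fun k => (hp _ (x k).2).2.differentiableAt) (fun t => ?_) (hp _ s₀.2).2.differentiableAt
    have h0 : Tendsto (fun k => 6 * Λ * |(x k : ℝ) - s₀|) atTop (𝓝 0) := by
      have := ((hx'.sub_const (s₀ : ℝ)).abs).const_mul (6 * Λ)
      simpa using this
    rw [tendsto_iff_norm_sub_tendsto_zero]
    exact squeeze_zero (fun k => norm_nonneg _)
      (fun k => by rw [Real.norm_eq_abs]; exact hpLip _ (x k).2 _ s₀.2 t) h0
  · -- existence of the limit at fixed `s`
    refine ((hder s hs).div_const 6).congr fun L => ?_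
    rw [(hfin s hs L).2.2, card_plaquette_four]
    have hN : ((L + 1 : ℕ) : ℝ) ≠ 0 := by positivity
    field_simp

end Summit.QuantumFields.YangMills.Theorems
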